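/-
Copyright (c) 2026 the pub-hodgecm-mathlib formalisation cell (harness21).  Prover seat hodgecm-mathlib-F0P3a-p05 (g17): road «S3-ram» (LEAD F0P3a-plan (g12); owner∕table
F0P3a-p06 (g15)), the (a2) JUNCTION (J★) of F0P3a-p01 (g17), J-PACK v2 §3 «ROW-REG-eq: off the root every fixed self-dual vertex has ¬LEV(ϖ^N)» (★ p847156 transported by ★
p847249 §4); 2026-09-02.
-/
import Literature.NumberTheory.Automorphic.UnitaryLatticeTreeFormTransport         -- ★ p847249 (F0P3a-p01 (g16)): `map_conj_sub_one_le_scaleLattice_iff`; brings ★ `UnitaryLatticeTreeFrameChange` (`mapGL_conj_mapGL_eq_iff`, `isSelfDualLattice_formCongr_iff`, `mapGL_mapGL_inv`), ★ `isVertexLattice_smul_iff`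
import Literature.NumberTheory.Automorphic.UnitaryLatticeTreeSeparableStableRoot    -- ★ (C1) p847156 (F0P3a-p01 (g16)): `eq_stdLattice_of_isSelfDualLattice_of_levelFixed_diagonal` (the equilateral root region is `{L₀}` in the diagonal model)
import Literature.NumberTheory.Automorphic.UnitaryLatticeTreeStabilizer             -- ★ (B-p14): `mapGL_stdLattice_eq_iff` (the stabiliser of `L₀` in `GL_N(K)` is `GL_N(𝒪)`)
import HarnessLib

/-!
# The lattice graph of a hermitian space — THE EQUILATERAL ROOT REGION IN THE `J₀`-MODEL IS THE ROOT: a self-dual vertex fixed AT LEVEL `ϖ^N` by `A·diag(s)·A⁻¹` (equilateral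
# spectrum of depth `N`) is `L₀` (Kottwitz 1986 §3; Rogawski 1990 §4.9; Bruhat–Tits 1972 §10)

Topic `NumberTheory/Automorphic`; namespace `Literature.NumberTheory.Automorphic.UnitaryLatticeTree`.  THEOREMS ONLY (no definition, no instance, no notation, no named fact,
no `sorry`); kernel lane `--supports stmt-HodgeConjecture-24833`; datum-free (`K` with `Valued K ℤᵐ⁰`, `σ` valuation-preserving).  Cell `pub/hodgecm-mathlib` (D-0151), crux
H413; road «S3-ram» (Literature seeding, count-neutral), organ A′e, the JUNCTION (J★) `stub_signedStrataCount_typeOne_ram` of F0P3a-p01 (g16∕g17).  J-PACK v2 (03ef5f1f) §3 lists,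
among the assembly pen's own steps, **ROW-REG-eq «off the root every fixed self-dual vertex has `¬LEV(ϖ^N)`» (★ p847156 transported by ★ p847249 §4)**: the engine's root REGION in
the equilateral configuration is `{r₀}` (skeleton v4: `R := {v ∈ F | SD v ∧ LEV[v](ϖ^{d₀})}`, "equilateral = the case `R = {r₀}`").  ★ p847156 (F0P3a-p01 (g16)) proves it in the
DIAGONAL model: a self-dual `M` for `diag d` with `T·M = M`, `(T − 1)·M ⊆ c·M`, `T = 1 + c·diag(s̃)`, `0 < |c| < 1`, `diag(s̃)` integral and residually separable, is `L₀`.  THIS FILE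
transports it to the `J₀`-model along `M ↦ A⁻¹·M` (`diag d = (−det diag d) • ᵗσ(A) J₀ A`, ★ J1; `γ = A·T·A⁻¹`): fixedness and the level token move by ★ p847249 §4
(`mapGL_conj_mapGL_eq_iff`, `map_conj_sub_one_le_scaleLattice_iff`), self-duality by ★ `isSelfDualLattice_formCongr_iff` ∘ ★ `isVertexLattice_smul_iff`, and `A·L₀ = L₀` because
`A, A⁻¹` are integral (★ `mapGL_stdLattice_eq_iff`).  §-last is the junction's dialect: spectrum `s` with `s 1 = 1`, `|s₀ − 1| = |s₂ − 1| = |s₀ − s₂| = |ϖ|^N` (`N ≥ 1`), `c = ϖ^N`,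
`s̃ᵢ = (sᵢ − 1)∕ϖ^N` (integral, residually separable: `s̃₁ = 0`, `|s̃₀| = |s̃₂| = |s̃₀ − s̃₂| = 1`).
HONEST LABEL: HC_CM is proved only modulo the 2 remaining named inputs (hLiu418 24832, h413 24833) until rung 0 closes; nothing printed is asserted here (bookkeeping).

* **`eq_stdLattice_of_isSelfDualLattice_antidiagonal_of_levelFixed_conj`** (lattice form: `M = L₀`), **`not_map_sub_one_le_scaleLattice_of_ne_root_of_conj`** (vertex form: `v ≠ r₀`
  fixed self-dual ⇒ `¬LEV[v](c)`), **`not_map_sub_one_le_scaleLattice_pow_of_ne_root_equilateral`** (junction dialect: equilateral `s`, `c = ϖ^N`).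

## References
* [Kottwitz1986] R. E. Kottwitz, *Base change for unit elements of Hecke algebras*, Compositio Math. 60 (1986), §3 (the fixed lattices of a regular elliptic element at the
  extreme level).
* [Rogawski1990] J. D. Rogawski, *Automorphic Representations of Unitary Groups in Three Variables*, Ann. of Math. Stud. 123 (1990), §4.9 pp. 54–55, Lemma 4.9.3.
* [BruhatTits1972] F. Bruhat, J. Tits, *Groupes réductifs sur un corps local I*, Publ. Math. IHÉS 41 (1972), §10 (stabilisers; functoriality in the form).
* [Serre1980Trees] J.-P. Serre, *Trees* (1980), Ch. II §1.1.
-/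

set_option autoImplicit false

noncomputable section

open scoped Valued WithZero Matrix MatrixGroups

namespace Literature.NumberTheory.Automorphic.UnitaryLatticeTree

open Literature.NumberTheory.Automorphic Literature.NumberTheory.Automorphic.HermitianLattice

variable {K : Type*} [Field K] [Valued K ℤᵐ⁰]

/-- **ROW-REG-eq «THE EQUILATERAL ROOT REGION IN THE J₀-MODEL IS `{A·L₀} = {L₀}`»**: for the ★ frame `A` (`A, A⁻¹` integral) of a diagonal unit form `diag d = (−det diag d) • ᵗσ(A) J₀ A`
and `γ ∈ U(σ, J₀)` with `↑γ = A·(1 + c·diag(s))·A⁻¹`, `0 < |c| < 1`, `diag(s)` integral and residually separable: a self-dual vertex `M` of the `J₀`-model with `γ·M = M` and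
`(γ − 1)·M ⊆ c·M` is the root `L₀` (★ p847156 in the diagonal model, transported along `M ↦ A⁻¹·M` by ★ p847249 §4 and the unit rescaling of the form).  Contrapositively: OFF THE ROOT
NO FIXED SELF-DUAL VERTEX HAS `LEV (c)` (the junction's «ROW-REG-eq», J-PACK v2 §3, with `c = ϖ^N` in the equilateral configuration). [cite: Kottwitz1986, §3] [cite: BruhatTits1972, §10]
[cite: Rogawski1990, §4.9 Lemma 4.9.3] -/
theorem eq_stdLattice_of_isSelfDualLattice_antidiagonal_of_levelFixed_conj {σ : K →+* K} (hvσ : ∀ a, Valued.v (σ a) = Valued.v a) {ϖ : K} (hϖ0 : ϖ ≠ 0)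
    (hϖ1 : Valued.v ϖ ≤ 1) {d : Fin 3 → K} (hd : ∀ i, Valued.v (d i) = 1)
    {A : GL (Fin 3) K} (hA : IsIntMatrix (A : Matrix (Fin 3) (Fin 3) K)) (hA' : IsIntMatrix ((A⁻¹ : GL (Fin 3) K) : Matrix (Fin 3) (Fin 3) K))
    (hdA : Matrix.diagonal d = (-(Matrix.diagonal d).det) • formCongr σ A ((StdForm.antidiagonal 3).over K))
    {s : Fin 3 → K} (hs : ∀ l, Valued.v (s l) ≤ 1) (hsep : ∀ i j, i ≠ j → Valued.v (s i - s j) = 1)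
    {c : K} (hc : c ≠ 0) (hc1 : Valued.v c < 1) (T : GL (Fin 3) K) (hT : (T : Matrix (Fin 3) (Fin 3) K) = 1 + c • Matrix.diagonal s)
    (γ : GL (Fin 3) K) (hγ : γ = A * T * A⁻¹)
    {M : Submodule 𝒪[K] (Fin 3 → K)} (hM : IsSelfDualLattice σ ϖ ((StdForm.antidiagonal 3).over K) M) (hfix : mapGL γ M = M)
    (hlev : M.map ((Matrix.toLin' ((γ : Matrix (Fin 3) (Fin 3) K) - 1)).restrictScalars 𝒪[K]) ≤ scaleLattice c M) :
    M = stdLattice K 3 := by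
  subst hγ
  have hcv : Valued.v (-(Matrix.diagonal d).det) = 1 := by
    rw [Valuation.map_neg, Matrix.det_diagonal, map_prod]
    exact Finset.prod_eq_one fun i _ => hd i
  -- `M = A·M′` with `M′ := A⁻¹·M` a self-dual lattice of the diagonal model, `T`-fixed at level `c`
  have hMM : mapGL A (mapGL A⁻¹ M) = M := mapGL_mapGL_inv A M
  have hM' : IsSelfDualLattice σ ϖ (Matrix.diagonal d) (mapGL A⁻¹ M) := by
    rw [hdA, IsSelfDualLattice, isVertexLattice_smul_iff (σ := σ) (ϖ := ϖ) hcv]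
    exact (isSelfDualLattice_formCongr_iff (σ := σ) (ϖ := ϖ) A _ _).2 (by rw [hMM]; exact hM)
  have hfix' : mapGL T (mapGL A⁻¹ M) = mapGL A⁻¹ M := by
    rw [← mapGL_conj_mapGL_eq_iff A, hMM]; exact hfix
  have hlev' : (mapGL A⁻¹ M).map ((Matrix.toLin' ((T : Matrix (Fin 3) (Fin 3) K) - 1)).restrictScalars 𝒪[K]) ≤ scaleLattice c (mapGL A⁻¹ M) := by
    rw [← map_conj_sub_one_le_scaleLattice_iff A, hMM]; exact hlev
  have hroot := eq_stdLattice_of_isSelfDualLattice_of_levelFixed_diagonal hvσ hϖ0 hϖ1 hd hs hsep hc hc1 T hT hM' hfix' hlev'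
  -- `M = A·L₀ = L₀`
  rw [← hMM, hroot]
  exact (mapGL_stdLattice_eq_iff A).2 ⟨hA, hA'⟩

/-- **OFF THE ROOT, NO `γ`-FIXED SELF-DUAL VERTEX OF THE J₀-MODEL HAS `LEV (c)`** (vertex form of the previous theorem; the junction's ROW-REG-eq at `c = ϖ^N`).
[cite: Kottwitz1986, §3] [cite: BruhatTits1972, §10] [cite: Rogawski1990, §4.9 Lemma 4.9.3] -/
theorem not_map_sub_one_le_scaleLattice_of_ne_root_of_conj {σ : K →+* K} (hvσ : ∀ a, Valued.v (σ a) = Valued.v a) {ϖ : K} (hϖ0 : ϖ ≠ 0)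
    (hϖ1 : Valued.v ϖ ≤ 1) {d : Fin 3 → K} (hd : ∀ i, Valued.v (d i) = 1)
    {A : GL (Fin 3) K} (hA : IsIntMatrix (A : Matrix (Fin 3) (Fin 3) K)) (hA' : IsIntMatrix ((A⁻¹ : GL (Fin 3) K) : Matrix (Fin 3) (Fin 3) K))
    (hdA : Matrix.diagonal d = (-(Matrix.diagonal d).det) • formCongr σ A ((StdForm.antidiagonal 3).over K))
    {s : Fin 3 → K} (hs : ∀ l, Valued.v (s l) ≤ 1) (hsep : ∀ i j, i ≠ j → Valued.v (s i - s j) = 1)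
    {c : K} (hc : c ≠ 0) (hc1 : Valued.v c < 1) (T : GL (Fin 3) K) (hT : (T : Matrix (Fin 3) (Fin 3) K) = 1 + c • Matrix.diagonal s)
    (γ : unitaryGroupOfForm σ ((StdForm.antidiagonal 3).over K)) (hγ : (γ : GL (Fin 3) K) = A * T * A⁻¹)
    {r₀ v : {M : Submodule 𝒪[K] (Fin 3 → K) // IsVertex σ ϖ ((StdForm.antidiagonal 3).over K) M}} (hr₀ : r₀.1 = stdLattice K 3)
    (hv : IsSelfDualLattice σ ϖ ((StdForm.antidiagonal 3).over K) v.1) (hvr : v ≠ r₀) (hfix : latticeGraphIso σ ϖ ((StdForm.antidiagonal 3).over K) γ v = v) :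
    ¬ v.1.map ((Matrix.toLin' (((γ : GL (Fin 3) K) : Matrix (Fin 3) (Fin 3) K) - 1)).restrictScalars 𝒪[K]) ≤ scaleLattice c v.1 := by
  intro hlev
  apply hvr
  apply Subtype.ext
  rw [hr₀]
  have hfix' : mapGL (γ : GL (Fin 3) K) v.1 = v.1 := congrArg Subtype.val hfix
  exact eq_stdLattice_of_isSelfDualLattice_antidiagonal_of_levelFixed_conj hvσ hϖ0 hϖ1 hd hA hA' hdA hs hsep hc hc1 T hT _ hγ hv hfix' hlev

/-- **ROW-REG-eq IN THE JUNCTION'S DIALECT (equilateral spectrum `s`, `s 1 = 1`, `|s₀ − 1| = |s₂ − 1| = |s₀ − s₂| = |ϖ|^N`, `N ≥ 1`)**: for `γ ∈ U(σ, J₀)` with `↑γ = A·diag(s)·A⁻¹`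
(`A` the ★ frame of `diag d`, `A, A⁻¹` integral), a `γ`-fixed self-dual vertex `v` other than the root (`r₀.1 = L₀`) does NOT have `LEV (ϖ^N)`: `(γ − 1)·v ⊄ ϖ^N·v`.
[cite: Kottwitz1986, §3] [cite: BruhatTits1972, §10] [cite: Rogawski1990, §4.9 Lemma 4.9.3] -/
theorem not_map_sub_one_le_scaleLattice_pow_of_ne_root_equilateral {σ : K →+* K} (hvσ : ∀ a, Valued.v (σ a) = Valued.v a) {ϖ : K}
    (hϖ : Valued.v ϖ = WithZero.exp (-1 : ℤ)) {d : Fin 3 → K} (hd : ∀ i, Valued.v (d i) = 1)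
    {A : GL (Fin 3) K} (hA : IsIntMatrix (A : Matrix (Fin 3) (Fin 3) K)) (hA' : IsIntMatrix ((A⁻¹ : GL (Fin 3) K) : Matrix (Fin 3) (Fin 3) K))
    (hdA : Matrix.diagonal d = (-(Matrix.diagonal d).det) • formCongr σ A ((StdForm.antidiagonal 3).over K))
    (γ : unitaryGroupOfForm σ ((StdForm.antidiagonal 3).over K)) {s : Fin 3 → K} (hs1 : s 1 = 1)
    (hγA : ((γ : GL (Fin 3) K) : Matrix (Fin 3) (Fin 3) K) = (A : Matrix (Fin 3) (Fin 3) K) * Matrix.diagonal s * ((A⁻¹ : GL (Fin 3) K) : Matrix (Fin 3) (Fin 3) K))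
    {N : ℕ} (hN1 : 1 ≤ N) (hs0 : Valued.v (s 0 - 1) = Valued.v ϖ ^ N) (hs2 : Valued.v (s 2 - 1) = Valued.v ϖ ^ N) (hs02 : Valued.v (s 0 - s 2) = Valued.v ϖ ^ N)
    {r₀ v : {M : Submodule 𝒪[K] (Fin 3 → K) // IsVertex σ ϖ ((StdForm.antidiagonal 3).over K) M}} (hr₀ : r₀.1 = stdLattice K 3)
    (hv : IsSelfDualLattice σ ϖ ((StdForm.antidiagonal 3).over K) v.1) (hvr : v ≠ r₀) (hfix : latticeGraphIso σ ϖ ((StdForm.antidiagonal 3).over K) γ v = v) :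
    ¬ v.1.map ((Matrix.toLin' (((γ : GL (Fin 3) K) : Matrix (Fin 3) (Fin 3) K) - 1)).restrictScalars 𝒪[K]) ≤ scaleLattice (ϖ ^ N) v.1 := by
  have hϖ0 : ϖ ≠ 0 := fun h0 => by rw [h0, map_zero] at hϖ; exact WithZero.coe_ne_zero hϖ.symm
  have hvϖ0 : Valued.v ϖ ≠ 0 := (Valuation.ne_zero_iff _).2 hϖ0
  have hϖ1 : Valued.v ϖ ≤ 1 := by rw [hϖ, ← WithZero.exp_zero]; exact WithZero.exp_le_exp.2 (by norm_num)
  have hϖlt : Valued.v ϖ < 1 := by rw [hϖ, ← WithZero.exp_zero]; exact WithZero.exp_lt_exp.2 (by norm_num)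
  have hc0 : (ϖ ^ N : K) ≠ 0 := pow_ne_zero _ hϖ0
  have hc1 : Valued.v (ϖ ^ N) < 1 := by rw [map_pow]; exact pow_lt_one₀ zero_le hϖlt (by omega)
  -- the normalised residual spectrum `s̃ i = (s i − 1) ∕ ϖ^N`
  have htv : ∀ l, Valued.v ((ϖ ^ N)⁻¹ * (s l - 1)) ≤ 1 := by
    intro l
    rw [map_mul, map_inv₀, map_pow]
    have hl : Valued.v (s l - 1) ≤ Valued.v ϖ ^ N := by
      fin_cases l
      · exact hs0.le
      · simp [hs1]
      · exact hs2.le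
    calc (Valued.v ϖ ^ N)⁻¹ * Valued.v (s l - 1) ≤ (Valued.v ϖ ^ N)⁻¹ * Valued.v ϖ ^ N := mul_le_mul' le_rfl hl
      _ = 1 := inv_mul_cancel₀ (pow_ne_zero _ hvϖ0)
  have hunit : ∀ x : K, Valued.v x = Valued.v ϖ ^ N → Valued.v ((ϖ ^ N)⁻¹ * x) = 1 := fun x hx => by
    rw [map_mul, map_inv₀, map_pow, hx, inv_mul_cancel₀ (pow_ne_zero _ hvϖ0)]
  have htsep : ∀ i j, i ≠ j → Valued.v ((ϖ ^ N)⁻¹ * (s i - 1) - (ϖ ^ N)⁻¹ * (s j - 1)) = 1 := by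
    intro i j hij
    rw [← mul_sub, sub_sub_sub_cancel_right]
    fin_cases i <;> fin_cases j <;> simp only [Fin.isValue, Fin.zero_eta, Fin.mk_one, Fin.reduceFinMk] at hij ⊢
    all_goals first
      | exact absurd rfl hij
      | (rw [hs1, ← sub_sub_sub_cancel_right (s 0) 1 1, sub_self]; simpa using hunit _ hs0)
      | skip
    · exact hunit _ hs02
    · rw [hs1, show (1 : K) - s 0 = -(s 0 - 1) by ring, mul_neg, Valuation.map_neg]; exact hunit _ hs0
    · rw [hs1, show (1 : K) - s 2 = -(s 2 - 1) by ring, mul_neg, Valuation.map_neg]; exact hunit _ hs2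
    · rw [show s 2 - s 0 = -(s 0 - s 2) by ring, mul_neg, Valuation.map_neg]; exact hunit _ hs02
    · rw [hs1]; exact hunit _ hs2
  -- `T := A⁻¹ γ A`, `↑T = diag s = 1 + ϖ^N • diag s̃`
  have hT : (((A⁻¹ * (γ : GL (Fin 3) K) * A : GL (Fin 3) K)) : Matrix (Fin 3) (Fin 3) K) = 1 + (ϖ ^ N) • Matrix.diagonal fun i => (ϖ ^ N)⁻¹ * (s i - 1) := by
    rw [Units.val_mul, Units.val_mul, hγA]
    have h1 : ((A⁻¹ : GL (Fin 3) K) : Matrix (Fin 3) (Fin 3) K) * ((A : Matrix (Fin 3) (Fin 3) K) * Matrix.diagonal s * ((A⁻¹ : GL (Fin 3) K) : Matrix (Fin 3) (Fin 3) K)) *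
        (A : Matrix (Fin 3) (Fin 3) K) = Matrix.diagonal s := by
      rw [← Matrix.mul_assoc, ← Matrix.mul_assoc, ← Units.val_mul, inv_mul_cancel, Units.val_one, Matrix.one_mul, Matrix.mul_assoc, ← Units.val_mul, inv_mul_cancel,
        Units.val_one, Matrix.mul_one]
    rw [h1, ← Matrix.diagonal_smul, ← Matrix.diagonal_one, Matrix.diagonal_add]
    congr 1
    funext i
    simp only [Pi.smul_apply, smul_eq_mul]
    rw [mul_inv_cancel_left₀ hc0, add_sub_cancel]
  have hγ : (γ : GL (Fin 3) K) = A * (A⁻¹ * (γ : GL (Fin 3) K) * A) * A⁻¹ := by group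
  exact not_map_sub_one_le_scaleLattice_of_ne_root_of_conj hvσ hϖ0 hϖ1 hd hA hA' hdA htv htsep hc0 hc1 _ hT γ hγ hr₀ hv hvr hfix

end Literature.NumberTheory.Automorphic.UnitaryLatticeTree

end
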